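import Mathlib
import Summits.Ventures.HodgeRepro2.T7SupportTwoTorusInvariant

/-!
# Tier7/Line3/KappaDefiniteBound — `0 ≤ κ ≤ 1` at a definite place (seat t7-x1)

LINE 3 (t7-plan-3), the two-torus relative trace formula, version-(ii) isolation. The product-formula separation
(`Tier7/Line3/ProductFormulaSeparation.inv_mul_pow_le_archSizeOn`) pushes the archimedean size of
`κ(γ) − κ(γ₀)` to infinity over a set `T` of infinite places PROVIDED the places outside `T` are bounded. For
LINE 3, `T = {ι₂, ι₃}` (the `U(1,1)`-places) and the place outside `T` is the DEFINITE place `ι₁`, where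
`U(W_A)(F_{ι₁}) = U(2)` is compact: THIS FILE proves, in p1's coordinates (`T7SupportTwoTorusInvariant`, row 662,
over `E = ℂ` with `σ = starRingEnd ℂ` (complex conjugation), `d i > 0`), that the double-coset invariant `κ(γ) = N(c₀₀)/(d₀ d'₀)` of an isometry `γ`
of the positive definite hermitian plane is a REAL number in `[0, 1]` — `N(c₀₀) = |c₀₀|² ≥ 0` and
`N(c₁₀) = (1 − κ) d₁ d'₀ ≥ 0` (p1's `nrm_cc_one_zero`) — hence `|κ(γ) − κ(γ₀)| ≤ 1` for any two isometries: the
bound `Binf ι₁ = 1` of the separation lemma. (Cauchy–Schwarz for the definite form, in the model.)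

Blind lane: Mathlib + the HodgeRepro2 prefix only; no sorry; axioms ⊆ {propext, Classical.choice, Quot.sound}.
-/

namespace Summit.Ventures.HodgeRepro2.Tier7.Line3.KappaDefiniteBound

open Summit.Ventures.HodgeRepro2.T7SupportTwoTorusInvariant Matrix

/-- the norm of the model is the square of the absolute value: `N(z) = z · conj z = |z|²`. -/
theorem nrm_conjC (z : ℂ) : nrm (starRingEnd ℂ) z = (Complex.normSq z : ℂ) := by
  simp [nrm, Complex.mul_conj]

/-- the hermitian form of a positive definite plane at a vector: a non-negative real number. -/
theorem herm_conjC_self (r : Fin 2 → ℝ) (x : Fin 2 → ℂ) :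
    herm (starRingEnd ℂ) (fun i => (r i : ℂ)) x x = ((∑ i, r i * Complex.normSq (x i) : ℝ) : ℂ) := by
  simp [herm, Complex.mul_conj]

/-- positivity of the definite form at a non-zero vector. -/
theorem sum_normSq_pos (r : Fin 2 → ℝ) (hr : ∀ i, 0 < r i) (x : Fin 2 → ℂ) (hx : x ≠ 0) :
    0 < ∑ i, r i * Complex.normSq (x i) := by
  obtain ⟨i, hi⟩ := Function.ne_iff.1 hx
  have hi0 : x i ≠ 0 := by simpa using hi
  have hi' : 0 < Complex.normSq (x i) := Complex.normSq_pos.2 hi0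
  refine Finset.sum_pos' (fun j _ => mul_nonneg (hr j).le (Complex.normSq_nonneg _)) ⟨i, Finset.mem_univ i, ?_⟩
  exact mul_pos (hr i) hi'

/-- **`κ` is a real number in `[0, 1]` at a definite place**: for an isometry `γ` of the positive definite
hermitian plane `h = d₀ x₀ ȳ₀ + d₁ x₁ ȳ₁` (`d i = r i > 0`) and a second basis with `f 0 ≠ 0`,
`κ(γ) = t` with `t : ℝ`, `0 ≤ t ≤ 1`. -/
theorem kappa_eq_real_mem_Icc (r : Fin 2 → ℝ) (hr : ∀ i, 0 < r i) (f : Fin 2 → Fin 2 → ℂ)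
    (hf0 : f 0 ≠ 0) (γ : Matrix (Fin 2) (Fin 2) ℂ) (hγ : IsIsom (starRingEnd ℂ) (fun i => (r i : ℂ)) γ) :
    ∃ t : ℝ, kappa (starRingEnd ℂ) (fun i => (r i : ℂ)) f γ = (t : ℂ) ∧ 0 ≤ t ∧ t ≤ 1 := by
  set d : Fin 2 → ℂ := fun i => (r i : ℂ) with hd_def
  have hd : ∀ i, (starRingEnd ℂ) (d i) = d i := fun i => by simp [hd_def]
  have hd0 : ∀ i, d i ≠ 0 := fun i => by
    simp only [hd_def]; exact_mod_cast (hr i).ne'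
  set s : ℝ := ∑ i, r i * Complex.normSq (f 0 i) with hs_def
  have hs : 0 < s := sum_normSq_pos r hr (f 0) hf0
  have hdisc : disc' (starRingEnd ℂ) d f 0 = (s : ℂ) := by
    simp only [disc', hd_def, hs_def]
    exact herm_conjC_self r (f 0)
  have hdisc0 : disc' (starRingEnd ℂ) d f 0 ≠ 0 := by
    rw [hdisc]; exact_mod_cast hs.ne'
  -- κ as a real number
  set t : ℝ := Complex.normSq (cc d f γ 0 0) / (r 0 * s) with ht_def
  have hκ : kappa (starRingEnd ℂ) d f γ = (t : ℂ) := by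
    unfold kappa
    rw [nrm_conjC, hdisc, ht_def]
    push_cast
    rfl
  refine ⟨t, hκ, ?_, ?_⟩
  · -- 0 ≤ t
    simp only [ht_def]
    exact div_nonneg (Complex.normSq_nonneg _) (mul_pos (hr 0) hs).le
  · -- t ≤ 1 from N(c 1 0) = (1 − κ) d₁ d'₀ ≥ 0
    have h10 := nrm_cc_one_zero (starRingEnd ℂ) d hd hd0 f hdisc0 γ hγ
    rw [nrm_conjC, hκ, hdisc] at h10
    have h10' : Complex.normSq (cc d f γ 1 0) = (1 - t) * r 1 * s := by
      have := congrArg Complex.re h10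
      simpa [hd_def] using this
    have hnn : 0 ≤ (1 - t) * (r 1 * s) := by
      rw [← mul_assoc, ← h10']; exact Complex.normSq_nonneg _
    have hpos : 0 < r 1 * s := mul_pos (hr 1) hs
    have : 0 ≤ 1 - t := nonneg_of_mul_nonneg_left hnn hpos
    linarith

/-- **`|κ(γ) − κ(γ₀)| ≤ 1` at a definite place**, for any two isometries — the bound `Binf ι₁ = 1` consumed by
`ProductFormulaSeparation.inv_mul_pow_le_archSizeOn` through `hT`. -/
theorem norm_kappa_sub_kappa_le_one (r : Fin 2 → ℝ) (hr : ∀ i, 0 < r i) (f : Fin 2 → Fin 2 → ℂ)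
    (hf0 : f 0 ≠ 0) (γ γ₀ : Matrix (Fin 2) (Fin 2) ℂ) (hγ : IsIsom (starRingEnd ℂ) (fun i => (r i : ℂ)) γ)
    (hγ₀ : IsIsom (starRingEnd ℂ) (fun i => (r i : ℂ)) γ₀) :
    ‖kappa (starRingEnd ℂ) (fun i => (r i : ℂ)) f γ - kappa (starRingEnd ℂ) (fun i => (r i : ℂ)) f γ₀‖ ≤ 1 := by
  obtain ⟨t, ht, ht0, ht1⟩ := kappa_eq_real_mem_Icc r hr f hf0 γ hγ
  obtain ⟨t₀, ht₀, ht₀0, ht₀1⟩ := kappa_eq_real_mem_Icc r hr f hf0 γ₀ hγ₀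
  rw [ht, ht₀, ← Complex.ofReal_sub, Complex.norm_real, Real.norm_eq_abs]
  exact abs_sub_le_iff.2 ⟨by linarith, by linarith⟩

end Summit.Ventures.HodgeRepro2.Tier7.Line3.KappaDefiniteBound
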